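import Summits.BirchSwinnertonDyer.BirchSwinnertonDyer.Theorems.GenusKolyvaginAtTwoPowDvdShaCardAtTwoPosTE4PosOfSockets
import Summits.BirchSwinnertonDyer.BirchSwinnertonDyer.Theorems.GenusKolyvaginAtTwoPowDvdShaCardAtTwoPosTTranspositionPairChebotarev
import Summits.BirchSwinnertonDyer.BirchSwinnertonDyer.Theorems.GenusKolyvaginAtTwoPowDvdShaCardAtTwoPosTEigenIndexTwoRegularSocket
import Summits.BirchSwinnertonDyer.BirchSwinnertonDyer.Theorems.GenusKolyvaginAtTwoPowDvdShaCardAtTwoPosTRankLeOnePosCut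
import Summits.BirchSwinnertonDyer.BirchSwinnertonDyer.Theorems.GenusKolyvaginAtTwoPowDvdShaCardAtTwoPosTDeepSwapSocketTransposition
import HarnessLib

/-!
# LINE «plus_descent_e4pos» = ROAD (E4)⁺ FOR L⁺_T′ `PowDvdShaCardAtTwoPosT` (stmt-BirchSwinnertonDyer-25501, rev 48 = R9-L/R9-FINAL): the skeleton
# (seat `bsd-line-gk2-p2` g22, (E4)⁺ assembly owner per LEAD ruling R10′/R10″)

NOT a proposal to the gate: a crux workfile (ONE sorry: `stub_bottomRungTransposition` = hbot⁺).  BSD is NOT proved by any of this; L⁺_T′ is NOT proved.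
`PowDvdShaCardAtTwoPosT_of : PowDvdShaCardAtTwoPosT` concludes the crux BY NAME (the route decl; text = R9-FINAL, identical to this seat's R9-L).

COMPOSITION (PROVED below modulo the stubs) = the LANDED sign-free assembly
`GenusExact.PlusDescent.pow_dvd_natCard_sha_of_sockets_of_rank_le_one_transposition` (`Theorems/…PosTE4PosOfSockets`, this seat): capstone p741898 ∘
X-ORTH∃⁺ `ctOrthogonalAtTwo_of_frame_transposition` (p756885) ∘ KS⁺ integrator `kolyvaginSuppliesAtTwo_of_deepSwap_transposition` (minima PROVED) ∘ the sockets,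
of which TWO are theorems already — hCheb := gk2-p5 g32 `exists_transposition_kolyvaginPrime_localization_fullOrder_pair_deep` (p756802), hK⁺ := gk2-p4 g24
`hK_socket_margin_of_frob_smul_ne` (p756743); R⁺ `rank E(K) ≤ 1` on the cut := this seat's `mordellWeilRank_baseChange_le_one_onPosCut` (p758733); hswap⁺ := gk2-p5 g32's `deepSwap_socket_transposition` (p758726) with (NPh_{L+1}) from the odd multiplicative place
(`NonPhantomPow.nonPhantomAtTwo_of_hasMultiplicativeReductionAt`) — and ONE is the stub:
* `stub_bottomRungTransposition` (hbot⁺) — a 2-primitive bottom rung at level `L = 2(M₀+6)` in the margin class, from the item's transposition-deep witness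
  `P(n₀) ∉ 2E(K[n₀])` (owner gk2-p4 g24 T1/T3 + gk2-p5 g32 T2; Δ<0 original `TransverseValue.hbot_socket_margin_onHabitat_of_three_le`);
Level `L = 2(M₀+6)`, margin `1`, class `G q := L + 1 ≤ idx q ∧ TRANSP q`; TRANSP = `∃ v 𝔓 (h : Γ_ℚ), q ∈ v ∧ 𝔓 ∈ v.primesAbove ∧ IsArithFrobAt (𝓞 ℚ) h 𝔓 ∧
∃ u : E[2], h • u ≠ u` (`geomTorsion W 2`; the item's `W.geomTorsion ((2 : ℕ) : ℤ)` converts by `exists_smul_ne_two_of_natCast`).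
-/


set_option autoImplicit false
set_option linter.dupNamespace false
set_option linter.unusedVariables false

noncomputable section

open scoped Classical
open scoped AddSubgroup
open Function Field NumberField IsDedekindDomain WeierstrassCurve
open Literature.NumberTheory.EllipticCurves Literature.NumberTheory.GaloisRepresentations
open Literature.NumberTheory.EllipticCurves.ModularForms
open Literature.NumberTheory.GaloisCohomology
open Summit.BirchSwinnertonDyer.Rank1Residual.JET.GlobalDuality
open Summit.BirchSwinnertonDyer.BirchSwinnertonDyer.Theses.GenusKolyvaginAtTwo
open Summit.BirchSwinnertonDyer.Rank1Residual
open Summit.BirchSwinnertonDyer.BirchSwinnertonDyer.Theorems.GenusExact.PlusDescent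

namespace Summit.BirchSwinnertonDyer.BirchSwinnertonDyer.Cruxes.PowDvdShaCardAtTwoPosT.PlusDescentE4Pos

/-- STUB hbot⁺ (gk2-p3): a 2-primitive bottom rung at level `L = 2(M₀+6)` in the margin class, from the transposition-deep witness. -/
theorem stub_bottomRungTransposition : KolyvaginRelationAtTwo → ∀ (W : WeierstrassCurve ℚ) [W.IsElliptic] [W.IsGloballyMinimal] [NeZero (W.conductorNorm ℤ)],
    ¬ W.HasCM → Odd W.tamagawaProduct → ∀ (v : HeightOneSpectrum (𝓞 ℚ)), ((2 : ℕ) : 𝓞 ℚ) ∉ v.asIdeal →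
    ((W.conductorNorm ℤ : ℕ) : 𝓞 ℚ) ∈ v.asIdeal → W.HasMultiplicativeReductionAt v →
    ∀ (K : Type) [Field K] [NumberField K], IsImaginaryQuadratic K → Odd (NumberField.discr K) → NumberField.discr K ≠ -3 →
    SatisfiesHeegnerHypothesis (W.conductorNorm ℤ) K → ¬ IsSquare ((NumberField.discr K : ℚ) * -|W.Δ|) →
    ¬ IsSquare ((NumberField.discr K : ℚ) * (-(2 * |W.Δ|))) → (∀ n : ℕ, 0 < n → W.HasSurjectiveModNGaloisRep ((2 : ℤ) ^ n)) →
    ∀ (τ : K ≃ₐ[ℚ] K), τ ≠ 1 → ∀ (Dt : ModularParametrizationData W (W.conductorNorm ℤ)) (β : ℤ) (ι : K →+* ℂ) (M₀ : ℕ),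
    ∀ (n₀ : ℕ) (e₀ : KolyvaginHeegnerData Dt β ι n₀), Squarefree n₀ →
    (∀ ℓ ∈ n₀.primeFactors, Zhang2014.IsKolyvaginPrime (W.conductorNorm ℤ) W K 2 ℓ ∧ 2 ≤ Zhang2014.kolyvaginIndex W 2 ℓ ∧
      (∃ (v : HeightOneSpectrum (𝓞 ℚ)) (𝔓 : Ideal (absIntegers (𝓞 ℚ) ℚ)) (h : absoluteGaloisGroup ℚ),
            (ℓ : 𝓞 ℚ) ∈ v.asIdeal ∧ 𝔓 ∈ v.primesAbove ∧ IsArithFrobAt (𝓞 ℚ) h 𝔓 ∧ ∃ u : geomTorsion W 2, h • u ≠ u)) →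
    (¬ ∃ Q : (W.baseChange (ringClassField K ι n₀)).toAffine.Point, (2 : ℤ) • Q = e₀.derivedPoint) →
    ∃ (n : ℕ) (d : KolyvaginHeegnerData Dt β ι n), Squarefree n ∧
      (∀ q ∈ n.primeFactors, (Zhang2014.IsKolyvaginPrime (W.conductorNorm ℤ) W K 2 q ∧ 2 * (M₀ + 6) ≤ Zhang2014.kolyvaginIndex W 2 q) ∧
        (2 * (M₀ + 6) + 1 ≤ Zhang2014.kolyvaginIndex W 2 q ∧
          (∃ (v : HeightOneSpectrum (𝓞 ℚ)) (𝔓 : Ideal (absIntegers (𝓞 ℚ) ℚ)) (h : absoluteGaloisGroup ℚ),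
            (q : 𝓞 ℚ) ∈ v.asIdeal ∧ 𝔓 ∈ v.primesAbove ∧ IsArithFrobAt (𝓞 ℚ) h 𝔓 ∧ ∃ u : geomTorsion W 2, h • u ≠ u))) ∧
      addOrderOf (d.kolyvaginClass Nat.prime_two (2 * (M₀ + 6))) = 2 ^ (2 * (M₀ + 6)) := by
  sorry

/-- **L⁺_T′ `PowDvdShaCardAtTwoPosT` (stmt-BirchSwinnertonDyer-25501) BY NAME FROM THE ONE OPEN STUB hbot⁺** — hCheb, hK⁺, hswap⁺ and R⁺ are discharged by the landed
theorems of gk2-p5 g32 (`exists_transposition_kolyvaginPrime_localization_fullOrder_pair_deep` p756802, `deepSwap_socket_transposition` p758726) and gk2-p4 g24 (`hK_socket_margin_of_frob_smul_ne`,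
p756743) and of this seat (`mordellWeilRank_baseChange_le_one_onPosCut`, p758733); everything else is this seat's sign-free assembly `pow_dvd_natCard_sha_of_sockets_of_rank_le_one_transposition`.  Sorry-free itself. -/
theorem PowDvdShaCardAtTwoPosT_of : PowDvdShaCardAtTwoPosT := by
  intro hQ2 W _ _ _ hcm hT v h2v hNv hmult _hpos K _ _ hIQ hodd h3 hHe hsq1 hsq2 hρ Dt β ι d₁ hy M₀ hdiv hndiv hw Wd _ _ hWd hSel _hTam
    n₀ e₀ hn₀ hKoly he₀
  obtain ⟨τ, hτ, -⟩ := exists_conj_of_isImaginaryQuadratic (K := K) hIQ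
  have hsurN' : ∀ m : ℕ, W.HasSurjectiveModNGaloisRep (2 ^ m : ℕ) := fun m ↦ by
    exact_mod_cast Summit.BirchSwinnertonDyer.BirchSwinnertonDyer.Theorems.MinimalTwinBSDTwo.forall_hasSurjectiveModNGaloisRep_two_pow_of_pos W hρ m
  -- R⁺: `rank E(K) ≤ 1` on the cut (this seat, `…PosTRankLeOnePosCut`, p758733)
  have hrk : (W.baseChange K).mordellWeilRank ≤ 1 :=
    mordellWeilRank_baseChange_le_one_onPosCut hQ2 W hcm hT v h2v hNv hmult K hIQ hodd h3 hHe hsq1 hsq2 hρ Dt β ι d₁ hy M₀ hndiv hw Wd hWd hSel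
  -- the item's witness clause in the Theorems' spelling (`geomTorsion W 2`)
  have hKoly' : ∀ ℓ ∈ n₀.primeFactors, Zhang2014.IsKolyvaginPrime (W.conductorNorm ℤ) W K 2 ℓ ∧ 2 ≤ Zhang2014.kolyvaginIndex W 2 ℓ ∧
      ∃ (v : HeightOneSpectrum (𝓞 ℚ)) (𝔓 : Ideal (absIntegers (𝓞 ℚ) ℚ)) (h : absoluteGaloisGroup ℚ),
        (ℓ : 𝓞 ℚ) ∈ v.asIdeal ∧ 𝔓 ∈ v.primesAbove ∧ IsArithFrobAt (𝓞 ℚ) h 𝔓 ∧ ∃ u : geomTorsion W 2, h • u ≠ u := by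
    intro ℓ hℓ
    obtain ⟨hZ, hidx, v', 𝔓, h, hv', h𝔓, hfr, hu⟩ := hKoly ℓ hℓ
    exact ⟨hZ, hidx, v', 𝔓, h, hv', h𝔓, hfr, exists_smul_ne_two_of_natCast W hu⟩
  exact pow_dvd_natCard_sha_of_sockets_of_rank_le_one_transposition hQ2 W hcm hT v h2v hNv hmult K hIQ hodd h3 hHe hsq1 hsq2 hρ Dt β ι d₁ hy
    M₀ hdiv hndiv hrk τ hτ
    (exists_transposition_kolyvaginPrime_localization_fullOrder_pair_deep W K hIQ hodd hHe hsurN' τ hτ (2 * (M₀ + 6)) 1 (by omega))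
    (stub_bottomRungTransposition hQ2 W hcm hT v h2v hNv hmult K hIQ hodd h3 hHe hsq1 hsq2 hρ τ hτ Dt β ι M₀ n₀ e₀ hn₀ hKoly' he₀)
    (deepSwap_socket_transposition W hcm hT hsurN' hIQ hodd h3 hHe τ hτ Dt β ι hQ2 (M₀ := M₀) (L := 2 * (M₀ + 6)) (k := 1) (by omega) le_rfl
      (Summit.BirchSwinnertonDyer.BirchSwinnertonDyer.Theorems.GenusExact.NonPhantomPow.nonPhantomAtTwo_of_hasMultiplicativeReductionAt W hT hρ hIQ hodd hsq1 hsq2 (NeZero.ne (W.conductorNorm ℤ)) hHe h2v hNv hmult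
        (2 * (M₀ + 6) + 1) (by omega)))
    (fun r ℓ hℓ C hC ↦ hK_socket_margin_of_frob_smul_ne W hIQ hτ (L := 2 * (M₀ + 6)) (by omega) r 1 ℓ hℓ C hC)

end Summit.BirchSwinnertonDyer.BirchSwinnertonDyer.Cruxes.PowDvdShaCardAtTwoPosT.PlusDescentE4Pos

end
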